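import Summits.PneNP.PneNP.Theorems.CliqueExtLowerBound.Negative.PermSpanProgram
import Summits.PneNP.PneNP.Theorems.CliqueExtLowerBound.Negative.LoadBearing

/-!
# `CliqueExtLowerBound` (stmt-PneNP-10682, route PneNP/ConvexRankGates) — negative-side lemmas: PERM consequences

Consequences of `PermSpanProgram.lean` (CLIQUE(m,k) is ONE PERM gate; 𝔽₂ span programs are PERM gates)
for the crux `CliqueExtLowerBound` and for its sub-basis sibling, crux #4 `LinAlgGateBlind`
(stmt-PneNP-10681), drawn by the standing adversary (cdisprove, gen 2):

* `abelianProgram_isPermGate` — the 𝔽₂ statement generalised verbatim to ANY finite abelian group `G`: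
  the gate "target `t ∈ 〈rows of the on-wires〉 ≤ (κ → G, +)`" is ONE PERM gate on `|G|·|κ|` points
  (translations of `G × κ`). So `PERM_s` contains every monotone span program over every prime field `𝔽_p`
  (additive closure in `𝔽_p^κ` = `𝔽_p`-span) of dimension `≤ s/p`, rows owned by wires — the precise sense
  of the route's "abelian case = monotone span programs over ℤ/q".
* `LinLowerBoundAt`, `linAlgGateBlind_iff` — schedule form of crux #4 (read-back by `Iff.rfl`);
  `linLowerBoundAt_of_lowerBoundAt` — the full-basis bound implies it.
* `not_linLowerBoundAt_of_choose_le` (+ `_const`, `_sub_const`) — ONE PERM gate kills every schedule with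
  `C(m, k m) ≤ m^j` (and `k m ≥ 2`) over the linear-algebra sub-basis: the schedule refutations of
  `LoadBearing.lean` §1 hold for crux #4 verbatim.
* `cliqueExtLowerBound_false_without_permDim` — the PERM dimension bound `d ≤ s` of the crux is
  load-bearing (dropping it falsifies the statement at `c = 0`), exactly like the CONV width bound.
* `msp_dim_lower_bound_of_cliqueExtLowerBound` — SANITY IMPLICATION: the crux implies that no 𝔽₂ monotone
  span program of dimension `≤ m^c / 2` (any number of rows, rows labelled by edges) computes
  CLIQUE(m, ⌈m^δ⌉₊), eventually in `m`, for every `c` — a superpolynomial mSP DIMENSION lower bound for the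
  diagonal clique family (consistent with the exponential mSP lower bounds in print, Pitassi–Robere 2018 via
  monotone projection; recorded so that a refutation of THIS consequence would refute the crux).

Refuter seat cdisprove-stmt-PneNP-10682-g2, 2026-08-15.
-/

namespace Summit.PneNP.PneNP.Theorems.CliqueExtLowerBound.Negative

open Literature.Computability.Complexity Literature.Computability.Complexity.CliqueLPGate Filter Finset
open Summit.PneNP.PneNP.Theses.ConvexRankGates (CliqueExtLowerBound LinAlgGateBlind)

/-! ### 1. Finite abelian group programs are PERM gates -/

section Abelian

variable {G : Type*} [AddCommGroup G] {κ : Type*}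

/-- Translation by `w` in the first coordinate of `G × κ`. [folklore] -/
def flipAuxG (w : κ → G) : Equiv.Perm (G × κ) where
  toFun p := (p.1 + w p.2, p.2)
  invFun p := (p.1 - w p.2, p.2)
  left_inv p := by simp
  right_inv p := by simp

/-- `flipAuxG` on points. [folklore] -/
@[simp] theorem flipAuxG_apply (w : κ → G) (p : G × κ) : flipAuxG w p = (p.1 + w p.2, p.2) := rfl

/-- `w ↦ flipAuxG w` as a monoid hom out of `Multiplicative (κ → G)`. [folklore] -/
def flipHomAuxG : Multiplicative (κ → G) →* Equiv.Perm (G × κ) where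
  toFun w := flipAuxG (Multiplicative.toAdd w)
  map_one' := by ext p : 1; simp
  map_mul' a b := by
    show flipAuxG (Multiplicative.toAdd (a * b)) = _
    rw [toAdd_mul]
    ext p : 1
    simp only [Equiv.Perm.mul_apply, flipAuxG_apply, Pi.add_apply, Prod.mk.injEq, and_true]
    abel

/-- `flipHomAuxG` is injective. [folklore] -/
theorem flipHomAuxG_injective : Function.Injective (flipHomAuxG (G := G) (κ := κ)) := by
  intro a b h
  have key : ∀ p, Multiplicative.toAdd a p = Multiplicative.toAdd b p := fun p => by
    have := congrArg (fun σ : Equiv.Perm (G × κ) => (σ (0, p)).1) h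
    simpa [flipHomAuxG] using this
  exact Multiplicative.toAdd.injective (funext key)

variable [Fintype G] [Fintype κ]

/-- The same, transported to `Fin (|G|·|κ|)` (the PERM gate format). [folklore] -/
noncomputable def flipHomG : Multiplicative (κ → G) →* Equiv.Perm (Fin (Fintype.card (G × κ))) :=
  (Equiv.permCongrHom (Fintype.equivFin (G × κ))).toMonoidHom.comp flipHomAuxG

/-- `flipHomG` is injective. [folklore] -/
theorem flipHomG_injective : Function.Injective (flipHomG (G := G) (κ := κ)) :=
  (Equiv.permCongrHom (Fintype.equivFin (G × κ))).injective.comp flipHomAuxG_injective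

/-- **Every finite abelian group program is ONE PERM gate on `|G|·|κ|` points**: rows `ρ i ∈ G^κ` owned by
wires, target `t`; accept `v` iff `t` lies in the subgroup generated by the rows of the on-wires. For
`G = ZMod p`, `p` prime, this is every monotone span program over `𝔽_p` of dimension `|κ|` (the additive
closure in `𝔽_p^κ` is the `𝔽_p`-span). [folklore] -/
theorem abelianProgram_isPermGate {n : ℕ} (ρ : Fin n → κ → G) (t : κ → G)
    (f : (Fin n → Bool) → Bool)
    (hf : ∀ v, f v = true ↔ Multiplicative.ofAdd t ∈
      Subgroup.closure ((fun i => Multiplicative.ofAdd (ρ i)) '' {i | v i = true})) :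
    IsPermGate (Fintype.card (G × κ)) ⟨n, f⟩ := by
  refine ⟨_, le_rfl, fun i => flipHomG (Multiplicative.ofAdd (ρ i)), flipHomG (Multiplicative.ofAdd t),
    fun v => ?_⟩
  show f v = true ↔ _
  rw [hf v]
  have himg : (fun i : Fin n => flipHomG (Multiplicative.ofAdd (ρ i))) '' {i | v i = true} =
      flipHomG '' ((fun i => Multiplicative.ofAdd (ρ i)) '' {i | v i = true}) :=
    (Set.image_image _ _ _).symm
  rw [himg, ← MonoidHom.map_closure, Subgroup.mem_map_iff_mem flipHomG_injective]

omit [AddCommGroup G] in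
/-- Width bookkeeping: `|G × κ| = |G|·|κ|`. [folklore] -/
theorem card_group_prod : Fintype.card (G × κ) = Fintype.card G * Fintype.card κ :=
  Fintype.card_prod _ _

end Abelian

/-! ### 2. Schedule refutations over the linear-algebra sub-basis (crux #4) -/

/-- Lower bound at schedule `k` over the LINEAR-ALGEBRA sub-basis `{∧₂, ∨₂} ∪ PERM_{m^c} ∪ GRANK_{m^c}`
(the basis of crux #4 `LinAlgGateBlind`, stmt-PneNP-10681). [folklore] -/
def LinLowerBoundAt (k : ℕ → ℕ) : Prop :=
  ∀ c : ℕ, ∀ᶠ m : ℕ in atTop, ∀ C : Circuit ((⊤ : SimpleGraph (Fin m)).edgeSet),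
    C.IsOver ({GateFn.and 2, GateFn.or 2} ∪ {g | IsPermGate (m ^ c) g ∨ IsGRankGate (m ^ c) g}) →
      C.size ≤ m ^ c → ¬ C.Computes (cliqueFn m (k m))

open Classical in
/-- Read-back of crux #4 `LinAlgGateBlind` in schedule form. [folklore] -/
theorem linAlgGateBlind_iff :
    LinAlgGateBlind ↔ ∃ δ : ℝ, 0 < δ ∧ δ < 1 / 2 ∧ LinLowerBoundAt (fun m => ⌈(m : ℝ) ^ δ⌉₊) :=
  Iff.rfl

/-- The full basis contains the linear-algebra sub-basis: `LowerBoundAt k → LinLowerBoundAt k`.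
[folklore] -/
theorem linLowerBoundAt_of_lowerBoundAt {k : ℕ → ℕ} (h : LowerBoundAt k) : LinLowerBoundAt k := by
  intro c
  filter_upwards [h c] with m hm C hC hs
  refine hm C (hC.mono ?_) hs
  rintro g (hg | hg)
  · exact monotoneBasis_subset_extGate _ hg
  · rcases hg with hg | hg
    · exact hg.mem_extGate
    · exact hg.mem_extGate

/-- **One PERM gate kills every polynomially-enumerable schedule over the linear-algebra sub-basis**:
if `C(m, k m) ≤ m^j` and `k m ≥ 2` eventually, then `LinLowerBoundAt k` is false. [folklore] -/
theorem not_linLowerBoundAt_of_choose_le {k : ℕ → ℕ} {j : ℕ} (h2 : ∀ᶠ m : ℕ in atTop, 2 ≤ k m)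
    (h : ∀ᶠ m : ℕ in atTop, m.choose (k m) ≤ m ^ j) : ¬ LinLowerBoundAt k := by
  intro hLB
  obtain ⟨m, hm, hk, hch, h3⟩ := ((hLB (j + 3)).and (h2.and (h.and (eventually_ge_atTop 3)))).exists
  obtain ⟨C, hC, hs, hc⟩ := exists_onePermGate_extGate_computes m (k m) hk
    (permWidth_le_of_choose_le m (k m) j h3 hch)
  refine hm C (hC.mono ?_) (hs.trans (Nat.one_le_pow _ _ (by omega))) hc
  rintro g (hg | hg)
  · exact Or.inl hg
  · exact Or.inr (Or.inl hg)

/-- Constant `k ≥ 2` over the linear-algebra sub-basis: false. [folklore] -/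
theorem not_linLowerBoundAt_const {k : ℕ} (hk : 2 ≤ k) : ¬ LinLowerBoundAt fun _ => k :=
  not_linLowerBoundAt_of_choose_le (j := k) (Eventually.of_forall fun _ => hk)
    (Eventually.of_forall fun m => Nat.choose_le_pow m k)

/-- `k = m - t` over the linear-algebra sub-basis: false. [folklore] -/
theorem not_linLowerBoundAt_sub_const (t : ℕ) : ¬ LinLowerBoundAt fun m => m - t := by
  refine not_linLowerBoundAt_of_choose_le (j := t) ?_ ?_
  · filter_upwards [eventually_ge_atTop (t + 2)] with m hm
    omega
  · filter_upwards [eventually_ge_atTop t] with m hm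
    rw [Nat.choose_symm hm]
    exact Nat.choose_le_pow m t

/-! ### 3. The PERM dimension bound is load-bearing for the crux -/

/-- **Any proof must use the PERM dimension bound** (not only the CONV width bound): the crux with `d ≤ s`
dropped in the PERM disjunct (PERM gates on ANY number of points; everything else as filed) is false already
at `c = 0` — ONE PERM gate (the 𝔽₂ cycle span program) computes CLIQUE(m, ⌈m^δ⌉₊). [folklore] -/
theorem cliqueExtLowerBound_false_without_permDim :
    ¬ ∃ δ : ℝ, 0 < δ ∧ δ < 1 / 2 ∧ ∀ c : ℕ, ∀ᶠ m : ℕ in atTop,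
      ∀ C : Circuit ((⊤ : SimpleGraph (Fin m)).edgeSet),
        C.IsOver ({GateFn.and 2, GateFn.or 2} ∪
          {g | IsConvGate (m ^ c) g ∨ (∃ w, IsPermGate w g) ∨ IsGRankGate (m ^ c) g}) →
        C.size ≤ m ^ c → ¬ C.Computes (cliqueFn m ⌈(m : ℝ) ^ δ⌉₊) := by
  rintro ⟨δ, hδ0, -, h⟩
  obtain ⟨m, hm, h2⟩ := ((h 0).and (eventually_ge_atTop 2)).exists
  obtain ⟨C, hC, hs, hc⟩ := exists_onePermGate_computes m ⌈(m : ℝ) ^ δ⌉₊ (two_le_ceil_rpow hδ0 h2)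
  refine hm C (hC.mono fun g hg => Or.inr (Or.inr (Or.inl ⟨_, hg⟩))) ?_ hc
  simpa using hs

/-! ### 4. Sanity implication: the crux gives a superpolynomial 𝔽₂-mSP DIMENSION lower bound for CLIQUE -/

/-- **The crux implies an 𝔽₂ monotone-span-program dimension lower bound**: if `CliqueExtLowerBound`
holds with exponent `δ`, then for every `c`, eventually in `m`, NO 𝔽₂ span program of dimension
`|κ| ≤ m^c / 2` — any number `n` of rows `ρ i`, row `i` labelled by the edge `w i`, target `t` —
computes CLIQUE(m, ⌈m^δ⌉₊) (it would be one PERM gate on `2|κ| ≤ m^c` points). [folklore] -/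
theorem msp_dim_lower_bound_of_cliqueExtLowerBound (h : CliqueExtLowerBound) :
    ∃ δ : ℝ, 0 < δ ∧ δ < 1 / 2 ∧ ∀ c : ℕ, ∀ᶠ m : ℕ in atTop,
      ∀ (κ : Type) [Fintype κ] (n : ℕ) (ρ : Fin n → κ → ZMod 2) (t : κ → ZMod 2)
        (w : Fin n → (⊤ : SimpleGraph (Fin m)).edgeSet), 2 * Fintype.card κ ≤ m ^ c →
        ¬ ∀ x : (⊤ : SimpleGraph (Fin m)).edgeSet → Bool, cliqueFn m ⌈(m : ℝ) ^ δ⌉₊ x = true ↔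
          Multiplicative.ofAdd t ∈ Subgroup.closure
            ((fun i => Multiplicative.ofAdd (ρ i)) '' {i | x (w i) = true}) := by
  classical
  obtain ⟨δ, hδ0, hδ1, hLB⟩ := cliqueExtLowerBound_iff.1 h
  refine ⟨δ, hδ0, hδ1, fun c => ?_⟩
  filter_upwards [hLB c, eventually_ge_atTop 1] with m hm h1 κ _ n ρ t w hcard hcomp
  -- the span program is one PERM gate of width 2|κ| ≤ m^c, wired by `w`
  let f : (Fin n → Bool) → Bool := fun v => decide (Multiplicative.ofAdd t ∈ Subgroup.closure
    ((fun i => Multiplicative.ofAdd (ρ i)) '' {i | v i = true}))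
  have hf : ∀ v, f v = true ↔ Multiplicative.ofAdd t ∈ Subgroup.closure
      ((fun i => Multiplicative.ofAdd (ρ i)) '' {i | v i = true}) := fun v => decide_eq_true_iff
  have hgate : IsPermGate (m ^ c) ⟨n, f⟩ :=
    (spanGate_isPermGate ρ t f hf).mono (by rw [card_zmod_two_prod]; exact hcard)
  obtain ⟨C, hC, hs, he⟩ := (CktSize.gate (B := extGate (m ^ c)) ⟨n, f⟩ hgate.mem_extGate w).toCircuit
  refine hm C hC (hs.trans (Nat.one_le_pow _ _ h1)) fun x => ?_
  rw [he x, Bool.eq_iff_iff]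
  show f (fun a => x (w a)) = true ↔ _
  rw [hf, hcomp x]

end Summit.PneNP.PneNP.Theorems.CliqueExtLowerBound.Negative
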